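/-
Copyright (c) 2026 the pub-hodgecm-mathlib formalisation cell (harness21).  Prover seat hodgecm-mathlib-LA1-p04 (g3), «GO 500» half A, L3 ROOF road (socket `stub_FROB`
→ `stub_ROOF0`), W1 LEGS leaflet drafting pen (LA3-plan (g2) STATUS #5 2026-09-02T07:37:33Z); the finiteness row for the `rk Γ(Ker q̄)` numerics of W5; 2026-09-02.
-/
import Literature.AlgebraicGeometry.AbelianSchemes.AbelianSchemeHomReductionSpecialFibreKernelRowsDeg
import HarnessLib

/-!
# REDUCTION OF A HOMOMORPHISM BETWEEN FIBRE TUPLES — THE REDUCED ISOGENY IS FINITE (row (i⁺) for the same `ū`)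
# ([SerreTate1968] §1; [BoschLutkebohmertRaynaud1990] §7.3 Prop. 6: an isogeny of the generic fibres extends to an isogeny of the models)

Topic `AlgebraicGeometry/AbelianSchemes`, namespace `Literature.AlgebraicGeometry.AbelianSchemes.AbelianSchemeOver`.  THEOREMS ONLY (no definition, no named fact, no
`instance`, no notation, no `sorry`).  Cell `hodgecm-mathlib` (D-0151), F0∕P6 «MOD», «GO 500» half A line L3, RULING (γ1) «ONE ∃, ONE ROOF DOWNSTAIRS».  Sequel of ★
`AbelianSchemeHomReductionSpecialFibreKernelRowsDeg`: the head **`exists_specialFibre_hom_reduction_kerRowsFin`** = ★ `exists_specialFibre_hom_reduction_kerRowsDeg` VERBATIM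
(binders; rows (i) (ii) (iii) (iv) (iv-h) (v-b-model) (v-a-model) (K2) (K4)) PLUS a tenth row **(i⁺)** «`IsFinite u.left → Surjective u.left → IsFinite ubar.left`» — for THE SAME
`ū`.  No new mathematics: ★ (ν7)'s turnkey says every fibre of the extension `U` over the refined Dedekind stage is an isogeny (`hisog`), so `ū = E_𝒜 ≫ U_{t′} ≫ E_𝒞⁻¹` is an
isogeny (★ `isIsogeny_hom_comp_iso`); ★ (ν8)'s row (i) exported only «flat ∧ surjective» of it and dropped the finiteness, which the consumers of the degree row need
(`Module.finrank κ̄ (Alg (Ker ū))` is the rank of a FINITE `κ̄`-scheme; ★ `finrank_alg_eq_mul_of_sup_eq_top` asks `Module.Finite`).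

WHY (L3 W5 `stub_ROOFGEO`, LA3-p02 (g3) census 2026-09-02T07:32:13Z; LA3-p03 (g3) `hcount`): `rk Γ(Ker q̄) = deg q̄ = deg q = #K(Ω̄)` is read off (K4) through ★
`finrank_ker_hom_of_isIsogeny`, which wants `q̄` to be an isogeny — (i) + (i⁺).  Consumer: ★ `RoofLegsSpecialFibreKernelRowsFin` (the legs with (FIN)(RK) rows), then the W1
LEGS leaflet ED. 1 §7.

HONEST LABEL: HC_CM is proved only modulo the cell's 2 remaining named inputs (hLiu418 24832, h413 24833) until rung 0 closes; generic capital on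
`--supports stmt-HodgeConjecture-24832`, pays no letter.

## References
* [SerreTate1968] J.-P. Serre, J. Tate, *Good reduction of abelian varieties*, Ann. of Math. 88 (1968), §1 (Lemma 2, Theorem 1).
* [BoschLutkebohmertRaynaud1990] S. Bosch, W. Lütkebohmert, M. Raynaud, *Néron Models* (1990), §1.2 Prop. 8, §7.3 Prop. 6 (p. 180).
* [GortzWedhorn2023] U. Görtz, T. Wedhorn, *Algebraic Geometry II* (2023), Cor. 27.177 (1).
* [MumfordFogartyKirwan1994] D. Mumford, J. Fogarty, F. Kirwan, *GIT*, 3rd ed., Ch. 6 §1 Cor. 6.2 (p. 116), Ch. 7 §2 Def. 7.1–7.2 (p. 129).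
* [MumfordAV1970] D. Mumford, *Abelian Varieties* (1970), §7 Thm. 4 (p. 72), §15 Thm. 1 (p. 143).
* [Hartshorne1977] R. Hartshorne, *Algebraic Geometry*, II.4.7 (valuative criterion).
-/

set_option autoImplicit false

noncomputable section

set_option backward.isDefEq.respectTransparency false

open CategoryTheory CategoryTheory.Limits AlgebraicGeometry MonoidalCategory CartesianMonoidalCategory
open scoped MonObj CategoryTheory.Obj NumberField
open Literature.AlgebraicGeometry.Motives
open IsDedekindDomain IsDedekindDomain.HeightOneSpectrum ValuativeRel
open Literature.NumberTheory.EllipticCurves (genericFibre specGenericPoint)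
open Literature.NumberTheory.GaloisRepresentations (closureValuationSubring)
open Literature.NumberTheory.DiophantineGeometry
open Literature.AlgebraicGeometry.GroupSchemes.GroupSchemeKernel (ker)

namespace Literature.AlgebraicGeometry.AbelianSchemes

namespace AbelianSchemeOver

universe u

section HeadFin

/-! ### §1 The head: ★ `exists_specialFibre_hom_reduction_kerRowsDeg` verbatim, with the finiteness row (i⁺) -/

variable {K : Type} [Field K] [NumberField K] {v : HeightOneSpectrum (𝓞 K)} {Y : SchemeOver K}
  (𝓨 : IntegralModel (valuationSubringAtPrime K v) K Y) [IsProper 𝓨.total.hom]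
  (𝒜 𝒞 : AbelianSchemeOver 𝓨.total.left) (x x'' : AlgPoints Y (AlgebraicClosure (v.adicCompletion K)))

set_option maxHeartbeats 800000 in -- = ★ (ν8h) p849598's budget for the same turnkey `obtain` (400 000 times out at `whnf`, measured on ★ (ν8k-b)); each row is one `exact`
/-- **THE SPECIAL FIBRE OF THE REDUCTION OF A HOMOMORPHISM BETWEEN FIBRE TUPLES — ALL KERNEL ROWS, THE DEGREE ROW AND THE FINITENESS ROW FROM ONE TURNKEY.**  As ★
`exists_specialFibre_hom_reduction_kerRowsDeg` (rows (i) (ii) (iii) (iv) (iv-h) (v-b-model) (v-a-model) (K2) (K4) verbatim) PLUS the tenth row **(i⁺)**: if `u` is finite surjective then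
`ū` is FINITE (`IsFinite ubar.left`) — the special fibre `U_{b′}` of the turnkey extension is an isogeny (`hisog`), hence so is `ū = E_𝒜 ≫ U_{b′} ≫ E_𝒞⁻¹` (★ `isIsogeny_hom_comp_iso`);
★ (ν8)'s row (i) keeps only «flat ∧ surjective» of that isogeny, this row keeps its finiteness (consumers count `rk Γ(Ker ū)`).
[cite: BoschLutkebohmertRaynaud1990, §7.3 Prop. 6 (p. 180)] [cite: GortzWedhorn2023, Cor. 27.177 (1)]
ORIGINAL ROWS:  Binders and rows (i) (ii) (iii) (iv) (iv-h) = ★ (ν8h)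
`exists_specialFibre_hom_reduction_comp` verbatim, plus `(act : 𝒜.RingAction 𝒪)`; rows (v-b-model) (v-a-model) = ★ (ν8R) `exists_specialFibre_hom_reduction_model` verbatim
(`R := 𝒪_Ω̄`, `x̃ := extendPoint …`, flat `𝒦 ↪ 𝒜_x̃`, read upstairs∕downstairs through the explicit three-piece isomorphisms of ★ (d5)); row (K2) = ★ (ν8k-b) (v-b) verbatim
(`IsFinite u → Surjective u → ∀ 𝔞, (Ker u ⊆ 𝒜_x[𝔞] on T-points) → (Ker ū ⊆ 𝒜_{x̄}[𝔞] on T-points)`).  All eight rows for THE SAME `ū`.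
[cite: SerreTate1968, §1 Lemma 2 and Theorem 1] [cite: BoschLutkebohmertRaynaud1990, §1.2 Prop. 8, §7.1 Prop. 6 and §7.3 Prop. 6 (p. 180)]
[cite: MumfordFogartyKirwan1994, Ch. 6 §1 Corollary 6.2 (p. 116); Ch. 7 §2 Definition 7.2 (p. 129)] [cite: MumfordAV1970, §15 Thm. 1 (p. 143)] [cite: Hartshorne1977, II.4.7] -/
theorem exists_specialFibre_hom_reduction_kerRowsFin
    (u : ((𝒜.baseChange (𝓨.genericIso'.inv.left ≫ pullback.fst 𝓨.total.hom (specGenericPoint (valuationSubringAtPrime K v) K))).baseChange x.left).X ⟶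
         ((𝒞.baseChange (𝓨.genericIso'.inv.left ≫ pullback.fst 𝓨.total.hom (specGenericPoint (valuationSubringAtPrime K v) K))).baseChange x''.left).X)
    [IsMonHom u]
    -- (ν8k-b) extra datum: an `𝒪`-action on `𝒜` (no Serre presentation is asked)
    {O : Type} [CommRing O] (act : 𝒜.RingAction O) :
    ∃ (ubar : ((𝒜.baseChange (pullback.fst 𝓨.total.hom (specResidueField v))).baseChange (𝓨.geomReductionMap x).left).X ⟶
               ((𝒞.baseChange (pullback.fst 𝓨.total.hom (specResidueField v))).baseChange (𝓨.geomReductionMap x'').left).X) (_ : IsMonHom ubar),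
      -- (i) finite surjective ⇒ flat surjective
      (IsFinite u.left → Surjective u.left → Flat ubar.left ∧ Function.Surjective ubar.left.base) ∧
      -- (ii) equivariance for endomorphism pairs transfers
      (∀ (f : 𝒜.X ⟶ 𝒜.X) (g : 𝒞.X ⟶ 𝒞.X) [IsMonHom f] [IsMonHom g],
        baseChangeHom (baseChangeHom f _) x.left ≫ u = u ≫ baseChangeHom (baseChangeHom g _) x''.left →
        baseChangeHom (baseChangeHom f (pullback.fst 𝓨.total.hom (specResidueField v))) (𝓨.geomReductionMap x).left ≫ ubar =
          ubar ≫ baseChangeHom (baseChangeHom g (pullback.fst 𝓨.total.hom (specResidueField v))) (𝓨.geomReductionMap x'').left) ∧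
      -- (iii) identities of section values transfer
      (∀ (τ : 𝒜.Sections) (τ'' : 𝒞.Sections),
        AlgPoints.map u ((𝒜.baseChange _).restrictPt x.left (𝒜.sectionBaseChange _ τ)) =
          (𝒞.baseChange _).restrictPt x''.left (𝒞.sectionBaseChange _ τ'') →
        AlgPoints.map ubar ((𝒜.baseChange (pullback.fst 𝓨.total.hom (specResidueField v))).restrictPt (𝓨.geomReductionMap x).left
            (𝒜.sectionBaseChange _ τ)) =
          (𝒞.baseChange (pullback.fst 𝓨.total.hom (specResidueField v))).restrictPt (𝓨.geomReductionMap x'').left (𝒞.sectionBaseChange _ τ'')) ∧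
      -- (iv) a polarisation law in dual-homomorphism form transfers
      (∀ (D𝒜 : 𝒜.DualPair) (pol𝒜 : 𝒜.Polarization D𝒜) (D𝒞 : 𝒞.DualPair) (pol𝒞 : 𝒞.Polarization D𝒞) (n : ℕ),
        u ≫ ((pol𝒞.baseChange _).baseChange x''.left).lam ≫ DualPair.dualIsogenyOver u ((D𝒜.baseChange _).baseChange x.left) ((D𝒞.baseChange _).baseChange x''.left) =
          ((pol𝒜.baseChange _).baseChange x.left).lam ≫ ((D𝒜.baseChange _).baseChange x.left).hat.mulN n →
        ubar ≫ ((pol𝒞.baseChange (pullback.fst 𝓨.total.hom (specResidueField v))).baseChange (𝓨.geomReductionMap x'').left).lam ≫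
            DualPair.dualIsogenyOver ubar ((D𝒜.baseChange (pullback.fst 𝓨.total.hom (specResidueField v))).baseChange (𝓨.geomReductionMap x).left)
              ((D𝒞.baseChange (pullback.fst 𝓨.total.hom (specResidueField v))).baseChange (𝓨.geomReductionMap x'').left) =
          ((pol𝒜.baseChange (pullback.fst 𝓨.total.hom (specResidueField v))).baseChange (𝓨.geomReductionMap x).left).lam ≫
            ((D𝒜.baseChange (pullback.fst 𝓨.total.hom (specResidueField v))).baseChange (𝓨.geomReductionMap x).left).hat.mulN n) ∧
      -- (iv-h) the polarisation law of a POST-COMPOSITE `u ≫ h_{x″}` with a MODEL homomorphism `h : 𝒞 → ℰ` transfers to `ū ≫ h_{x̄″}` (this file)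
      (∀ (ℰ : AbelianSchemeOver 𝓨.total.left) (h : 𝒞.X ⟶ ℰ.X) [IsMonHom h]
        (u₂ : ((𝒜.baseChange (𝓨.genericIso'.inv.left ≫ pullback.fst 𝓨.total.hom (specGenericPoint (valuationSubringAtPrime K v) K))).baseChange x.left).X ⟶
          ((ℰ.baseChange (𝓨.genericIso'.inv.left ≫ pullback.fst 𝓨.total.hom (specGenericPoint (valuationSubringAtPrime K v) K))).baseChange x''.left).X) [IsMonHom u₂],
        u₂ = u ≫ baseChangeHom (baseChangeHom h (𝓨.genericIso'.inv.left ≫ pullback.fst 𝓨.total.hom (specGenericPoint (valuationSubringAtPrime K v) K))) x''.left →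
        ∀ (D𝒜 : 𝒜.DualPair) (pol𝒜 : 𝒜.Polarization D𝒜) (Dℰ : ℰ.DualPair) (polℰ : ℰ.Polarization Dℰ) (n : ℕ),
        u₂ ≫ ((polℰ.baseChange (𝓨.genericIso'.inv.left ≫ pullback.fst 𝓨.total.hom (specGenericPoint (valuationSubringAtPrime K v) K))).baseChange x''.left).lam ≫
            DualPair.dualIsogenyOver u₂ ((D𝒜.baseChange (𝓨.genericIso'.inv.left ≫ pullback.fst 𝓨.total.hom (specGenericPoint (valuationSubringAtPrime K v) K))).baseChange x.left) ((Dℰ.baseChange (𝓨.genericIso'.inv.left ≫ pullback.fst 𝓨.total.hom (specGenericPoint (valuationSubringAtPrime K v) K))).baseChange x''.left) =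
          ((pol𝒜.baseChange (𝓨.genericIso'.inv.left ≫ pullback.fst 𝓨.total.hom (specGenericPoint (valuationSubringAtPrime K v) K))).baseChange x.left).lam ≫ ((D𝒜.baseChange (𝓨.genericIso'.inv.left ≫ pullback.fst 𝓨.total.hom (specGenericPoint (valuationSubringAtPrime K v) K))).baseChange x.left).hat.mulN n →
        ∀ (w : ((𝒜.baseChange (pullback.fst 𝓨.total.hom (specResidueField v))).baseChange (𝓨.geomReductionMap x).left).X ⟶
          ((ℰ.baseChange (pullback.fst 𝓨.total.hom (specResidueField v))).baseChange (𝓨.geomReductionMap x'').left).X) [IsMonHom w],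
        w = ubar ≫ baseChangeHom (baseChangeHom h (pullback.fst 𝓨.total.hom (specResidueField v))) (𝓨.geomReductionMap x'').left →
        w ≫ ((polℰ.baseChange (pullback.fst 𝓨.total.hom (specResidueField v))).baseChange (𝓨.geomReductionMap x'').left).lam ≫
            DualPair.dualIsogenyOver w ((D𝒜.baseChange (pullback.fst 𝓨.total.hom (specResidueField v))).baseChange (𝓨.geomReductionMap x).left) ((Dℰ.baseChange (pullback.fst 𝓨.total.hom (specResidueField v))).baseChange (𝓨.geomReductionMap x'').left) =
          ((pol𝒜.baseChange (pullback.fst 𝓨.total.hom (specResidueField v))).baseChange (𝓨.geomReductionMap x).left).lam ≫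
            ((D𝒜.baseChange (pullback.fst 𝓨.total.hom (specResidueField v))).baseChange (𝓨.geomReductionMap x).left).hat.mulN n) ∧
      -- (v-b-model) [★ (ν8R)] KILL along a flat `𝒦 ↪ 𝒜_x̃` over the valuation ring `R = 𝒪_Ω̄` of the point (`x̃` the `R`-point extending `x`): if `𝒦_η`, read in `(𝒜_η)_x` through the
      -- three-piece isomorphism of ★ (d5), is killed by `u`, then `𝒦_s`, read in `(𝒜_s)_x̄`, is killed by `ū`
      (∀ (𝒦 : Over (Spec (.of (closureValuationSubring (v.adicCompletion K))))) (incl : 𝒦 ⟶ (𝒜.baseChange (extendPoint (closureValuationSubring (v.adicCompletion K)) (toClosureValuationSubring v) 𝓨.total (𝓨.modelPointsEquiv.symm x)).left).X) [Flat 𝒦.hom],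
        ((Over.pullback (specFractionFieldι (closureValuationSubring (v.adicCompletion K)) (toClosureValuationSubring v)).left).map incl ≫
            (𝒜.fibreBaseChangeIso (𝓨.genericIso'.inv.left ≫ pullback.fst 𝓨.total.hom (specGenericPoint (valuationSubringAtPrime K v) K)) x.left ≪≫ 𝒜.fibreCongrPtIso (𝓨.left_specFractionFieldι_comp_extendPoint_modelPointsEquiv_symm x).symm ≪≫ (𝒜.fibreBaseChangeIso (extendPoint (closureValuationSubring (v.adicCompletion K)) (toClosureValuationSubring v) 𝓨.total (𝓨.modelPointsEquiv.symm x)).left (specFractionFieldι (closureValuationSubring (v.adicCompletion K)) (toClosureValuationSubring v)).left).symm).inv.hom.hom.hom) ≫ u = 1 →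
        ((Over.pullback ((geomClosedPointIsoSpecResidueField v).inv.left ≫ (specRingHomι (closureValuationSubring (v.adicCompletion K)) (toClosureValuationSubring v) (IsLocalRing.residue (closureValuationSubring (v.adicCompletion K)))).left)).map incl ≫
            (𝒜.fibreBaseChangeIso (pullback.fst 𝓨.total.hom (specResidueField v)) (𝓨.geomReductionMap x).left ≪≫ 𝒜.fibreCongrPtIso ((𝓨.left_geomReductionMap_comp_fst x).trans (Category.assoc _ _ _).symm) ≪≫ (𝒜.fibreBaseChangeIso (extendPoint (closureValuationSubring (v.adicCompletion K)) (toClosureValuationSubring v) 𝓨.total (𝓨.modelPointsEquiv.symm x)).left ((geomClosedPointIsoSpecResidueField v).inv.left ≫ (specRingHomι (closureValuationSubring (v.adicCompletion K)) (toClosureValuationSubring v) (IsLocalRing.residue (closureValuationSubring (v.adicCompletion K)))).left)).symm).inv.hom.hom.hom) ≫ ubar = 1) ∧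
      -- (v-a-model) [★ (ν8R)] the kernel CLAUSE along a flat closed `𝒦 ↪ 𝒜_x̃`, for `u` finite surjective: `𝒦_η = Ker u` on `T`-points ⇒ `𝒦_s = Ker ū` on `T`-points
      (∀ (𝒦 : Over (Spec (.of (closureValuationSubring (v.adicCompletion K))))) (incl : 𝒦 ⟶ (𝒜.baseChange (extendPoint (closureValuationSubring (v.adicCompletion K)) (toClosureValuationSubring v) 𝓨.total (𝓨.modelPointsEquiv.symm x)).left).X) [Flat 𝒦.hom] [IsClosedImmersion incl.left],
        IsFinite u.left → Surjective u.left →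
        (∀ ⦃W : Over (Spec (.of (AlgebraicClosure (v.adicCompletion K))))⦄ (t : W ⟶ ((𝒜.baseChange (extendPoint (closureValuationSubring (v.adicCompletion K)) (toClosureValuationSubring v) 𝓨.total (𝓨.modelPointsEquiv.symm x)).left).baseChange (specFractionFieldι (closureValuationSubring (v.adicCompletion K)) (toClosureValuationSubring v)).left).X),
          (∃ s : W ⟶ (Over.pullback (specFractionFieldι (closureValuationSubring (v.adicCompletion K)) (toClosureValuationSubring v)).left).obj 𝒦, s ≫ (Over.pullback (specFractionFieldι (closureValuationSubring (v.adicCompletion K)) (toClosureValuationSubring v)).left).map incl = t) ↔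
            (t ≫ (𝒜.fibreBaseChangeIso (𝓨.genericIso'.inv.left ≫ pullback.fst 𝓨.total.hom (specGenericPoint (valuationSubringAtPrime K v) K)) x.left ≪≫ 𝒜.fibreCongrPtIso (𝓨.left_specFractionFieldι_comp_extendPoint_modelPointsEquiv_symm x).symm ≪≫ (𝒜.fibreBaseChangeIso (extendPoint (closureValuationSubring (v.adicCompletion K)) (toClosureValuationSubring v) 𝓨.total (𝓨.modelPointsEquiv.symm x)).left (specFractionFieldι (closureValuationSubring (v.adicCompletion K)) (toClosureValuationSubring v)).left).symm).inv.hom.hom.hom) ≫ u = 1) →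
        ∀ ⦃W : Over (Spec (.of (geomResidueField v)))⦄ (t : W ⟶ ((𝒜.baseChange (extendPoint (closureValuationSubring (v.adicCompletion K)) (toClosureValuationSubring v) 𝓨.total (𝓨.modelPointsEquiv.symm x)).left).baseChange ((geomClosedPointIsoSpecResidueField v).inv.left ≫ (specRingHomι (closureValuationSubring (v.adicCompletion K)) (toClosureValuationSubring v) (IsLocalRing.residue (closureValuationSubring (v.adicCompletion K)))).left)).X),
          (∃ s : W ⟶ (Over.pullback ((geomClosedPointIsoSpecResidueField v).inv.left ≫ (specRingHomι (closureValuationSubring (v.adicCompletion K)) (toClosureValuationSubring v) (IsLocalRing.residue (closureValuationSubring (v.adicCompletion K)))).left)).obj 𝒦, s ≫ (Over.pullback ((geomClosedPointIsoSpecResidueField v).inv.left ≫ (specRingHomι (closureValuationSubring (v.adicCompletion K)) (toClosureValuationSubring v) (IsLocalRing.residue (closureValuationSubring (v.adicCompletion K)))).left)).map incl = t) ↔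
            (t ≫ (𝒜.fibreBaseChangeIso (pullback.fst 𝓨.total.hom (specResidueField v)) (𝓨.geomReductionMap x).left ≪≫ 𝒜.fibreCongrPtIso ((𝓨.left_geomReductionMap_comp_fst x).trans (Category.assoc _ _ _).symm) ≪≫ (𝒜.fibreBaseChangeIso (extendPoint (closureValuationSubring (v.adicCompletion K)) (toClosureValuationSubring v) 𝓨.total (𝓨.modelPointsEquiv.symm x)).left ((geomClosedPointIsoSpecResidueField v).inv.left ≫ (specRingHomι (closureValuationSubring (v.adicCompletion K)) (toClosureValuationSubring v) (IsLocalRing.residue (closureValuationSubring (v.adicCompletion K)))).left)).symm).inv.hom.hom.hom) ≫ ubar = 1) ∧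
      -- (K2) [★ (ν8k-b)] a ONE-SIDED kernel bound `Ker u ⊆ 𝒜_x[𝔞]` on all `T`-points transfers to `Ker ū ⊆ 𝒜_{x̄}[𝔞]` on ALL `T`-points, for every ideal `𝔞` (★ `AbelianSchemeHomReductionSpecialFibreKernelBound` §2)
      (IsFinite u.left → Surjective u.left → ∀ 𝔞 : Ideal O,
        (∀ ⦃T : Over (Spec (.of (AlgebraicClosure (v.adicCompletion K))))⦄ (t : T ⟶ ((𝒜.baseChange (𝓨.genericIso'.inv.left ≫ pullback.fst 𝓨.total.hom (specGenericPoint (valuationSubringAtPrime K v) K))).baseChange x.left).X),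
          t ≫ u = 1 → ∀ r ∈ 𝔞, t ≫ ((act.baseChange (𝓨.genericIso'.inv.left ≫ pullback.fst 𝓨.total.hom (specGenericPoint (valuationSubringAtPrime K v) K))).baseChange x.left).i r = 1) →
        ∀ ⦃T : Over (Spec (.of (geomResidueField v)))⦄ (t : T ⟶ ((𝒜.baseChange (pullback.fst 𝓨.total.hom (specResidueField v))).baseChange (𝓨.geomReductionMap x).left).X),
          t ≫ ubar = 1 → ∀ r ∈ 𝔞, t ≫ ((act.baseChange (pullback.fst 𝓨.total.hom (specResidueField v))).baseChange (𝓨.geomReductionMap x).left).i r = 1) ∧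
      -- (K4) the DEGREE row (this file): `u` finite surjective ⇒ `deg ū = deg u` (`kerRank` of the morphisms of abelian varieties; §2 at the Dedekind stage `Spec D′`)
      (IsFinite u.left → Surjective u.left → AbelianVariety.Hom.kerRank (homOfIsMonHom ubar) = AbelianVariety.Hom.kerRank (homOfIsMonHom u)) ∧
      -- (i⁺) the FINITENESS row (this file): `u` finite surjective ⇒ `ū` finite (the turnkey's special fibre is an isogeny; ★ (ν8) (i) drops this)
      (IsFinite u.left → Surjective u.left → IsFinite ubar.left) := by
  -- the homomorphism of abelian varieties underlying `u`, and the TURNKEY reduction ★ (ν7)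
  obtain ⟨D, _i1, _i2, L, _i3, _i4, _i5, _i6, _i7, _i8, gD, h, hh, hgD, ha, z, z'', hz, hz'', L', _j1, _j2, _j3, _j4, _j5, χ, h', U, hU,
      hpt, hpt'', e, hspt, hspt'', et, hχ, hh', hh'h, hDed, hFrac, hfib, huniq, hisog⟩ :=
    exists_stage_hom_reduction_turnkey 𝓨 𝒜 𝒞 x x'' (homOfIsMonHom u)
  haveI := hDed
  haveI := hFrac
  haveI := hU
  -- injectivity of restriction to the `Ω`-point `ξ′` of the refined stage (schematically dominant: `D′ → Ω` injective)
  have h'inj : Function.Injective h' := by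
    intro a b hab
    have h1 : χ (a : L') = χ (b : L') := by rw [← hh', ← hh', hab]
    exact Subtype.ext (hχ h1)
  haveI : IsDominant (specGenericPoint (closureValuationSubring (v.adicCompletion K)) (AlgebraicClosure (v.adicCompletion K)) ≫ Spec.map (CommRingCat.ofHom h')) := by
    haveI := isDominant_specMap_of_injective
      (algebraMap (closureValuationSubring (v.adicCompletion K)) (AlgebraicClosure (v.adicCompletion K))) Subtype.val_injective
    haveI := isDominant_specMap_of_injective h' h'inj
    infer_instance
  haveI : IsSchemeTheoreticallyDominant (specGenericPoint (closureValuationSubring (v.adicCompletion K)) (AlgebraicClosure (v.adicCompletion K)) ≫ Spec.map (CommRingCat.ofHom h')) := IsSchemeTheoreticallyDominant.of_isDominant _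
  -- the refined stage `Spec D′` is connected, reduced, Noetherian (Dedekind); the generic point of the valuation ring `R` is schematically dominant
  haveI : IsNoetherianRing (integralClosure D L') := inferInstance
  haveI : QuasiCompact (specFractionFieldι (closureValuationSubring (v.adicCompletion K)) (toClosureValuationSubring v)).left :=
    inferInstanceAs (QuasiCompact (Spec.map (CommRingCat.ofHom (algebraMap (closureValuationSubring (v.adicCompletion K)) (AlgebraicClosure (v.adicCompletion K))))))
  haveI : IsSchemeTheoreticallyDominant (specFractionFieldι (closureValuationSubring (v.adicCompletion K)) (toClosureValuationSubring v)).left :=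
    Literature.AlgebraicGeometry.Limits.isSchemeTheoreticallyDominant_specMap_of_injective
      (algebraMap (closureValuationSubring (v.adicCompletion K)) (AlgebraicClosure (v.adicCompletion K))) Subtype.val_injective
  -- the `R`-point `x̃` factors through the refined stage: `x̃ = Spec h′ ≫ Spec (D → D′) ≫ z`
  have hxR : (extendPoint (closureValuationSubring (v.adicCompletion K)) (toClosureValuationSubring v) 𝓨.total (𝓨.modelPointsEquiv.symm x)).left = (Spec.map (CommRingCat.ofHom h') ≫ (Spec.map (CommRingCat.ofHom (algebraMap D (integralClosure D L'))))) ≫ z.left := by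
    rw [← hz, ← hh'h, CommRingCat.ofHom_comp, Spec.map_comp]
  -- ALL SIX TRANSFERS AT ONCE (★ (ν8R) `specialFibre_transfers_of_generic_model` at the turnkey's stage and the `R`-model `𝒜_x̃`)
  have H := specialFibre_transfers_of_generic_model (𝓨.genericIso'.inv.left ≫ pullback.fst 𝓨.total.hom (specGenericPoint (valuationSubringAtPrime K v) K)) z.left z''.left (Spec.map (CommRingCat.ofHom (algebraMap D (integralClosure D L')))) x.left x''.left (specGenericPoint (closureValuationSubring (v.adicCompletion K)) (AlgebraicClosure (v.adicCompletion K)) ≫ Spec.map (CommRingCat.ofHom h)) (specGenericPoint (closureValuationSubring (v.adicCompletion K)) (AlgebraicClosure (v.adicCompletion K)) ≫ Spec.map (CommRingCat.ofHom h')) hpt hpt'' e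
    (pullback.fst 𝓨.total.hom (specResidueField v)) (𝓨.geomReductionMap x).left (𝓨.geomReductionMap x'').left (((geomClosedPointIsoSpecResidueField v).inv.left ≫ (specRingHomι (closureValuationSubring (v.adicCompletion K)) (toClosureValuationSubring v) (IsLocalRing.residue (closureValuationSubring (v.adicCompletion K)))).left) ≫ Spec.map (CommRingCat.ofHom h)) (((geomClosedPointIsoSpecResidueField v).inv.left ≫ (specRingHomι (closureValuationSubring (v.adicCompletion K)) (toClosureValuationSubring v) (IsLocalRing.residue (closureValuationSubring (v.adicCompletion K)))).left) ≫ Spec.map (CommRingCat.ofHom h')) hspt hspt'' et 𝒜 𝒞 U u hfib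
    (Spec.map (CommRingCat.ofHom h')) (extendPoint (closureValuationSubring (v.adicCompletion K)) (toClosureValuationSubring v) 𝓨.total (𝓨.modelPointsEquiv.symm x)).left hxR (specFractionFieldι (closureValuationSubring (v.adicCompletion K)) (toClosureValuationSubring v)).left ((geomClosedPointIsoSpecResidueField v).inv.left ≫ (specRingHomι (closureValuationSubring (v.adicCompletion K)) (toClosureValuationSubring v) (IsLocalRing.residue (closureValuationSubring (v.adicCompletion K)))).left) rfl rfl
    (𝓨.left_specFractionFieldι_comp_extendPoint_modelPointsEquiv_symm x).symm ((𝓨.left_geomReductionMap_comp_fst x).trans (Category.assoc _ _ _).symm)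
  refine ⟨_, H.fst, fun hfin hsurj => H.snd.1 (hisog ⟨hsurj, hfin⟩ _), H.snd.2.1, H.snd.2.2.1, H.snd.2.2.2.1, ?_,
    fun 𝒦 incl _ hk => H.snd.2.2.2.2.1 𝒦 incl hk,
    fun 𝒦 incl _ _ hfin hsurj hc W t =>
      H.snd.2.2.2.2.2 (flat_ker_hom L' U (hisog ⟨hsurj, hfin⟩ (specGenericPoint (integralClosure D L') L'))) 𝒦 incl hc t, ?_, ?_, ?_⟩
  · -- (iv-h) the post-composite (★ (ν8h) §1 `specialFibre_postcomp_comp_lam_comp_dualIsogenyOver_eq_of_generic`)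
    intro ℰ hm _ u₂ _ hu₂eq D𝒜 pol𝒜 Dℰ polℰ n hlam w _ hweq
    exact specialFibre_postcomp_comp_lam_comp_dualIsogenyOver_eq_of_generic (𝓨.genericIso'.inv.left ≫ pullback.fst 𝓨.total.hom (specGenericPoint (valuationSubringAtPrime K v) K)) z.left z''.left (Spec.map (CommRingCat.ofHom (algebraMap D (integralClosure D L')))) x.left x''.left (specGenericPoint (closureValuationSubring (v.adicCompletion K)) (AlgebraicClosure (v.adicCompletion K)) ≫ Spec.map (CommRingCat.ofHom h)) (specGenericPoint (closureValuationSubring (v.adicCompletion K)) (AlgebraicClosure (v.adicCompletion K)) ≫ Spec.map (CommRingCat.ofHom h')) hpt hpt'' e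
      (pullback.fst 𝓨.total.hom (specResidueField v)) (𝓨.geomReductionMap x).left (𝓨.geomReductionMap x'').left (((geomClosedPointIsoSpecResidueField v).inv.left ≫ (specRingHomι (closureValuationSubring (v.adicCompletion K)) (toClosureValuationSubring v) (IsLocalRing.residue (closureValuationSubring (v.adicCompletion K)))).left) ≫ Spec.map (CommRingCat.ofHom h)) (((geomClosedPointIsoSpecResidueField v).inv.left ≫ (specRingHomι (closureValuationSubring (v.adicCompletion K)) (toClosureValuationSubring v) (IsLocalRing.residue (closureValuationSubring (v.adicCompletion K)))).left) ≫ Spec.map (CommRingCat.ofHom h')) hspt hspt'' et 𝒜 𝒞 U u hfib ℰ hm D𝒜 pol𝒜 Dℰ polℰ n u₂ hu₂eq hlam w hweq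
  · -- (K2) the one-sided kernel bound (★ (ν8k-b) §2 `comp_specialFibre_i_eq_one_of_generic`; `Ker U → Spec D′` is flat, ★ `flat_ker_hom`)
    intro hfin hsurj 𝔞 hle T t ht
    haveI : Flat (ker U).hom := flat_ker_hom L' U (hisog ⟨hsurj, hfin⟩ (specGenericPoint (integralClosure D L') L'))
    exact comp_specialFibre_i_eq_one_of_generic (𝓨.genericIso'.inv.left ≫ pullback.fst 𝓨.total.hom (specGenericPoint (valuationSubringAtPrime K v) K)) z.left z''.left (Spec.map (CommRingCat.ofHom (algebraMap D (integralClosure D L')))) x.left x''.left (specGenericPoint (closureValuationSubring (v.adicCompletion K)) (AlgebraicClosure (v.adicCompletion K)) ≫ Spec.map (CommRingCat.ofHom h)) (specGenericPoint (closureValuationSubring (v.adicCompletion K)) (AlgebraicClosure (v.adicCompletion K)) ≫ Spec.map (CommRingCat.ofHom h')) hpt hpt'' e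
      (pullback.fst 𝓨.total.hom (specResidueField v)) (𝓨.geomReductionMap x).left (𝓨.geomReductionMap x'').left (((geomClosedPointIsoSpecResidueField v).inv.left ≫ (specRingHomι (closureValuationSubring (v.adicCompletion K)) (toClosureValuationSubring v) (IsLocalRing.residue (closureValuationSubring (v.adicCompletion K)))).left) ≫ Spec.map (CommRingCat.ofHom h)) (((geomClosedPointIsoSpecResidueField v).inv.left ≫ (specRingHomι (closureValuationSubring (v.adicCompletion K)) (toClosureValuationSubring v) (IsLocalRing.residue (closureValuationSubring (v.adicCompletion K)))).left) ≫ Spec.map (CommRingCat.ofHom h')) hspt hspt'' et 𝒜 𝒞 U u hfib act 𝔞 hle t ht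
  · -- (K4) the degree row (§2 `kerRank_specialFibre_eq_of_generic` at the Dedekind stage `Spec D′`: `hDed`, `hFrac`, generic isogeny by `hisog`)
    intro hfin hsurj
    have hu : AbelianVariety.IsIsogeny (homOfIsMonHom u) := ⟨hsurj, hfin⟩
    exact kerRank_specialFibre_eq_of_generic L' (𝓨.genericIso'.inv.left ≫ pullback.fst 𝓨.total.hom (specGenericPoint (valuationSubringAtPrime K v) K)) z.left z''.left (Spec.map (CommRingCat.ofHom (algebraMap D (integralClosure D L')))) x.left x''.left (specGenericPoint (closureValuationSubring (v.adicCompletion K)) (AlgebraicClosure (v.adicCompletion K)) ≫ Spec.map (CommRingCat.ofHom h)) (specGenericPoint (closureValuationSubring (v.adicCompletion K)) (AlgebraicClosure (v.adicCompletion K)) ≫ Spec.map (CommRingCat.ofHom h')) hpt hpt'' e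
      (pullback.fst 𝓨.total.hom (specResidueField v)) (𝓨.geomReductionMap x).left (𝓨.geomReductionMap x'').left (((geomClosedPointIsoSpecResidueField v).inv.left ≫ (specRingHomι (closureValuationSubring (v.adicCompletion K)) (toClosureValuationSubring v) (IsLocalRing.residue (closureValuationSubring (v.adicCompletion K)))).left) ≫ Spec.map (CommRingCat.ofHom h)) (((geomClosedPointIsoSpecResidueField v).inv.left ≫ (specRingHomι (closureValuationSubring (v.adicCompletion K)) (toClosureValuationSubring v) (IsLocalRing.residue (closureValuationSubring (v.adicCompletion K)))).left) ≫ Spec.map (CommRingCat.ofHom h')) hspt hspt'' et 𝒜 𝒞 U u hfib (hisog hu (specGenericPoint (integralClosure D L') L')) hu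
  · -- (i⁺) finite surjective ⇒ FINITE: `u` an isogeny ⇒ `U_{t′}` is (★ (ν7) `hisog`) ⇒ `ū = E_𝒜 ≫ U_{t′} ≫ E_𝒞⁻¹` is (★ `isIsogeny_hom_comp_iso`)
    intro hfin hsurj
    have hu : AbelianVariety.IsIsogeny (homOfIsMonHom u) := ⟨hsurj, hfin⟩
    have hub : AbelianVariety.IsIsogeny ((𝒜.fibreBaseChangeIso (pullback.fst 𝓨.total.hom (specResidueField v)) (𝓨.geomReductionMap x).left ≪≫ 𝒜.fibreCongrPtIso hspt ≪≫ (𝒜.fibreBaseChangeIso z.left (((geomClosedPointIsoSpecResidueField v).inv.left ≫ (specRingHomι (closureValuationSubring (v.adicCompletion K)) (toClosureValuationSubring v) (IsLocalRing.residue (closureValuationSubring (v.adicCompletion K)))).left) ≫ Spec.map (CommRingCat.ofHom h))).symm ≪≫ ((𝒜.baseChange z.left).fibreCongrPtIso et).symm ≪≫ ((𝒜.baseChange z.left).fibreBaseChangeIso (Spec.map (CommRingCat.ofHom (algebraMap D (integralClosure D L')))) (((geomClosedPointIsoSpecResidueField v).inv.left ≫ (specRingHomι (closureValuationSubring (v.adicCompletion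 K)) (toClosureValuationSubring v) (IsLocalRing.residue (closureValuationSubring (v.adicCompletion K)))).left) ≫ Spec.map (CommRingCat.ofHom h'))).symm).hom ≫ fibreHom U (((geomClosedPointIsoSpecResidueField v).inv.left ≫ (specRingHomι (closureValuationSubring (v.adicCompletion K)) (toClosureValuationSubring v) (IsLocalRing.residue (closureValuationSubring (v.adicCompletion K)))).left) ≫ Spec.map (CommRingCat.ofHom h')) ≫ (𝒞.fibreBaseChangeIso (pullback.fst 𝓨.total.hom (specResidueField v)) (𝓨.geomReductionMap x'').left ≪≫ 𝒞.fibreCongrPtIso hspt'' ≪≫ (𝒞.fibreBaseChangeIso z''.left (((geomClosedPointIsoSpecResidueField v).inv.left ≫ (specRingHomι (closureValuationSubring (v.adicCompletion K)) (toClosureValuationSubring v) (IsLocalRing.residue (closureValuationSubring (v.adicCompletion K)))).left) ≫ Spec.map (CommRingCat.ofHom h))).symm ≪≫ ((𝒞.baseChange z''.left).fibreCongrPtIso et).symm ≪≫ ((𝒞.baseChange z''.left).fibreBaseChangeIso (Spec.map (CommRingCat.ofHom (algebraMap D (integralClosure D L')))) (((geomClosedPointIsoSpecResidueField v).inv.left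 ≫ (specRingHomι (closureValuationSubring (v.adicCompletion K)) (toClosureValuationSubring v) (IsLocalRing.residue (closureValuationSubring (v.adicCompletion K)))).left) ≫ Spec.map (CommRingCat.ofHom h'))).symm).inv) :=
      isIsogeny_hom_comp_iso (𝒜.fibreBaseChangeIso (pullback.fst 𝓨.total.hom (specResidueField v)) (𝓨.geomReductionMap x).left ≪≫ 𝒜.fibreCongrPtIso hspt ≪≫ (𝒜.fibreBaseChangeIso z.left (((geomClosedPointIsoSpecResidueField v).inv.left ≫ (specRingHomι (closureValuationSubring (v.adicCompletion K)) (toClosureValuationSubring v) (IsLocalRing.residue (closureValuationSubring (v.adicCompletion K)))).left) ≫ Spec.map (CommRingCat.ofHom h))).symm ≪≫ ((𝒜.baseChange z.left).fibreCongrPtIso et).symm ≪≫ ((𝒜.baseChange z.left).fibreBaseChangeIso (Spec.map (CommRingCat.ofHom (algebraMap D (integralClosure D L')))) (((geomClosedPointIsoSpecResidueField v).inv.left ≫ (specRingHomι (closureValuationSubring (v.adicCompletion K)) (toClosureValuationSubring v) (IsLocalRing.residue (closureValuationSubring (v.adicCompletion K)))).left) ≫ Spec.map (CommRingCat.ofHom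 h'))).symm) (fibreHom U (((geomClosedPointIsoSpecResidueField v).inv.left ≫ (specRingHomι (closureValuationSubring (v.adicCompletion K)) (toClosureValuationSubring v) (IsLocalRing.residue (closureValuationSubring (v.adicCompletion K)))).left) ≫ Spec.map (CommRingCat.ofHom h'))) (𝒞.fibreBaseChangeIso (pullback.fst 𝓨.total.hom (specResidueField v)) (𝓨.geomReductionMap x'').left ≪≫ 𝒞.fibreCongrPtIso hspt'' ≪≫ (𝒞.fibreBaseChangeIso z''.left (((geomClosedPointIsoSpecResidueField v).inv.left ≫ (specRingHomι (closureValuationSubring (v.adicCompletion K)) (toClosureValuationSubring v) (IsLocalRing.residue (closureValuationSubring (v.adicCompletion K)))).left) ≫ Spec.map (CommRingCat.ofHom h))).symm ≪≫ ((𝒞.baseChange z''.left).fibreCongrPtIso et).symm ≪≫ ((𝒞.baseChange z''.left).fibreBaseChangeIso (Spec.map (CommRingCat.ofHom (algebraMap D (integralClosure D L')))) (((geomClosedPointIsoSpecResidueField v).inv.left ≫ (specRingHomι (closureValuationSubring (v.adicCompletion K)) (toClosureValuationSubring v) (IsLocalRing.residue (closureValuationSubring (v.adicCompletion K)))).left)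 ≫ Spec.map (CommRingCat.ofHom h'))).symm).symm (hisog hu (((geomClosedPointIsoSpecResidueField v).inv.left ≫ (specRingHomι (closureValuationSubring (v.adicCompletion K)) (toClosureValuationSubring v) (IsLocalRing.residue (closureValuationSubring (v.adicCompletion K)))).left) ≫ Spec.map (CommRingCat.ofHom h')))
    exact hub.2

end HeadFin

end AbelianSchemeOver

end Literature.AlgebraicGeometry.AbelianSchemes

end
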